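import Literature.Probability.RandomPlanarGeometry.HexSAWSurfaceWallDensityRenewalReward
import Literature.Probability.RandomPlanarGeometry.HexSAWSurfaceWallRenewalExcessLimit
import Literature.Probability.RandomPlanarGeometry.HexSAWSurfaceWallDensityCoefficient
import HarnessLib

/-!
# To second order every renewal block visits the surface exactly once: `y²(V(y) − 1) → 0`, `V − 1 = O(y^{−5/2})`,
# and the three second-order coefficients of the adsorbed wall agree: `y²(m − V) → 2 = 2 − 0 = 2m·1`

Topic `Literature/Probability/RandomPlanarGeometry` (lane «pcv-sawmu», a-idea-1 g30, car «VISIT-EXCESS»; parents: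
`HexSAWSurfaceWallDensityRenewalReward.lean` («NO-KINK»: the visit polynomials `Λ^v_n(y) = IPWBV n y = Σ_ω visits·y^{visits}`,
the mean number of surface visits per renewal block `V(y) = pwbVisitMean y = Σ_s Λ^v_{2s}(y) β(y)^{−2s}`, and the renewal–reward
identity `ρ^±(t) = V(eᵗ)/(2m(eᵗ))` for the contact densities at every `eᵗ > μ⁴`), `HexSAWSurfaceWallRenewalExcessLimit.lean`
(«EXCESS-LIMIT»: the analytic census of the short irreducible positive wall bridges — `ipwb 4 = ∅`, one visit on every block of
length `6` and `8`, at most two at length `10` — and the tail bound `Σ_{j ≥ 0}(j+5) f_{j+6} ≤ 12μ¹⁴/(y²√y)` for `y ≥ 48`), and the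
TREE's `HexSAWSurfaceWallDensityCoefficient.lean` («WALL-DENSITY-COEFFICIENT»: `e^{2t}(1/2 − ρ⁺(t)) → 1`).

WHAT IS NEW.  (1) THE VISIT EXCESS IS THIRD ORDER.  `V(y) − 1 = Σ_s (Λ^v_{2s} − Λ_{2s})(y) β^{−2s} = Σ_s Σ_{ω ∈ ipwb 2s}
(visits − 1) y^{visits} β^{−2s}` (Kesten's identity `Σ_s f_s = 1`); by the census the blocks of half-length `s ≤ 4` all have ONE
visit, so their terms VANISH IDENTICALLY (`IPWBV_two`, `IPWBV_four`, `IPWBV_six : Λ^v₆ = y`, `IPWBV_eight : Λ^v₈ = #(ipwb 8)·y`);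
the `s = 5` term is `≤ #(ipwb 10)·y²/β¹⁰ ≤ 3¹⁰/y³` (at most two visits, `β² ≥ y`), and for `s ≥ 6` the entropy lemma
`2Λ^v_{2s} ≤ (s+1)Λ_{2s}` gives `(Λ^v − Λ)_{2s} β^{−2s} ≤ ((s−1)/2) f_s`, whose sum is HALF the excess tail of «EXCESS-LIMIT».  Hence
  ★★ `pwbVisitMean_sub_one_le (48 ≤ y) : V(y) − 1 ≤ 59049/y³ + 6μ¹⁴/(y²√y)`,  `0 ≤ V − 1` (y > μ⁴),
  ★★★ `tendsto_sq_mul_pwbVisitMean_sub_one : y²(V(y) − 1) → 0`,  ★ `isBigO_pwbVisitMean_sub_one : V − 1 = O(1/(y²√y))`: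
to second order in `1/y` the mean number of surface visits of a renewal block is exactly ONE (the atom and the dip both visit once),
while the mean half-LENGTH exceeds one by `2/y²` («EXCESS-LIMIT»).
(2) THE CROSS-CHECK OF THREE INDEPENDENT SECOND-ORDER COEFFICIENTS.  From the tree's density coefficient and «NO-KINK» alone (no
census): `m − V = 2m(1/2 − ρ⁺(log y))` (`pwbMean_sub_pwbVisitMean_eq`) and ★★ `tendsto_sq_mul_pwbMean_sub_pwbVisitMean :
y²(m(y) − V(y)) → 2`.  With «EXCESS-LIMIT»'s `y²(m − 1) → 2` and (1)'s `y²(V − 1) → 0` the three limits satisfy `2 = 2 − 0`: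
the convexity/chord computation of the density coefficient (a-p6), the Fréchet/renewal–reward identity (car «NO-KINK») and the
analytic census (car «EXCESS-LIMIT») are mutually consistent — a T5-style consistency check, machine-checked.

The sources treat: Kesten's irreducible-bridge renewal and `Σ λ_n β^{−n} = 1` [MadrasSlade1993, §4.2, (4.2.2)–(4.2.5), Theorem
4.2.2; remark before (4.2.21)], [Kesten1963SAW, §4]; renewal–reward [Giacomin2011, Chapter 2, (2.9)–(2.11)], [Feller1968, XIII.3];
adsorbed honeycomb walks, the free energy `log β` and the contact density [BeatonBousquetMelouDeGierDuminilCopinGuttmann2014, §3.1,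
Proposition 5], [JansevanRensburg2000, §3.3]; strong-adsorption expansions [JansevanRensburgWhittington2013, §3.1]; the frame
[EntingJensen2009, §7.4.2].  NOT claimed: the coefficient of `y⁻³` in `V − 1` (it is `N₅₂ = #{two-visit blocks of length 10}`,
not determined here), anything at `y ≤ μ⁴`, numerics.  No statement of the parents or of the tree's coefficient files is restated:
the limits here concern `V`, which the tree does not have; `y²(1/2 − ρ⁺(log y)) → 1` is USED (from the tree), not re-proved.
-/

noncomputable section

namespace Literature.Probability.RandomPlanarGeometry.SAW.HexBW.Wall

open Finset Filter Function Asymptotics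
open Literature.Probability.LatticeModels
open _root_.Topology

variable {y : ℝ} {n : ℕ} {ω : ℕ → Site 2}

/-! ### §0 Private helpers -/

/-- `μ² = 2 + √2`. [cite: DuminilCopinSmirnov2012, Theorem 1] -/
private theorem mu_sq_vx : hexConnectiveConstant ^ 2 = 2 + Real.sqrt 2 := by
  rw [hexConnectiveConstant_eq_inv, inv_pow]; exact inv_eq_of_mul_eq_one_right hexCriticalFugacity_sq

/-- `4 ≤ μ⁴`. [cite: DuminilCopinSmirnov2012, Theorem 1] -/
private theorem four_le_mu_four_vx : 4 ≤ hexConnectiveConstant ^ 4 := by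
  have h2 : 0 ≤ Real.sqrt 2 := Real.sqrt_nonneg 2
  calc (4 : ℝ) ≤ (2 + Real.sqrt 2) ^ 2 := by nlinarith
    _ = hexConnectiveConstant ^ 4 := by rw [← mu_sq_vx]; ring

/-- `μ⁴ < 12`. [cite: DuminilCopinSmirnov2012, Theorem 1] -/
private theorem mu_four_lt_twelve_vx : hexConnectiveConstant ^ 4 < 12 := by
  have hup : Real.sqrt 2 ≤ 1.41422 := by
    rw [show (1.41422 : ℝ) = Real.sqrt (1.41422 ^ 2) by rw [Real.sqrt_sq (by norm_num)]]
    exact Real.sqrt_le_sqrt (by norm_num)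
  have h2 : 0 ≤ Real.sqrt 2 := Real.sqrt_nonneg 2
  calc hexConnectiveConstant ^ 4 = (hexConnectiveConstant ^ 2) ^ 2 := by ring
    _ = (2 + Real.sqrt 2) ^ 2 := by rw [mu_sq_vx]
    _ ≤ (2 + 1.41422) ^ 2 := by gcongr
    _ < 12 := by norm_num

/-- `48 ≤ y ⇒ μ⁴ < y`. [cite: DuminilCopinSmirnov2012, Theorem 1] -/
private theorem mu_four_lt_of_ge_vx (hy : 48 ≤ y) : hexConnectiveConstant ^ 4 < y :=
  mu_four_lt_twelve_vx.trans_le (by linarith)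

/-- `y ≤ β(y)²` (`β ≥ √y`). [cite: BeatonBousquetMelouDeGierDuminilCopinGuttmann2014, §3.1, Proposition 5 (arXiv v5 p. 9)] -/
private theorem le_sq_wallRate_vx (hy : 0 < y) : y ≤ wallRate y ^ 2 := by
  have h := pow_le_pow_left₀ (Real.sqrt_nonneg y) (sqrt_le_wallRate hy) 2
  rwa [Real.sq_sqrt hy.le] at h

/-- `m(y) → 1` as `y → ∞` (squeeze between `1 ≤ m` and the tree's explicit bound `m ≤ 1 + μ⁴ θ/(1 − θ)²`, `θ = μ²/√y → 0`).
[cite: MadrasSlade1993, §4.2, Theorem 4.2.2(b) (pp. 91–92)] -/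
private theorem tendsto_pwbMean_vx : Tendsto pwbMean atTop (𝓝 1) := by
  have hθ : Tendsto (fun y : ℝ => hexConnectiveConstant ^ 2 / Real.sqrt y) atTop (𝓝 0) :=
    tendsto_const_nhds.div_atTop Real.tendsto_sqrt_atTop
  have hc : Tendsto (fun _ : ℝ => (1 : ℝ)) atTop (𝓝 1) := tendsto_const_nhds
  have hden : Tendsto (fun y : ℝ => (1 - hexConnectiveConstant ^ 2 / Real.sqrt y) ^ 2) atTop (𝓝 1) := by
    simpa using (hc.sub hθ).pow 2
  have hup : Tendsto (fun y : ℝ => 1 + hexConnectiveConstant ^ 4 *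
      ((hexConnectiveConstant ^ 2 / Real.sqrt y) / (1 - hexConnectiveConstant ^ 2 / Real.sqrt y) ^ 2)) atTop (𝓝 1) := by
    simpa using ((hθ.div hden one_ne_zero).const_mul (hexConnectiveConstant ^ 4)).const_add 1
  refine tendsto_of_tendsto_of_tendsto_of_le_of_le' tendsto_const_nhds hup ?_ ?_
  · filter_upwards [eventually_gt_atTop (hexConnectiveConstant ^ 4)] with y hy using one_le_pwbMean hy
  · filter_upwards [eventually_gt_atTop (hexConnectiveConstant ^ 4)] with y hy using pwbMean_le hy

/-! ### §1 The visit excess of a block polynomial, and its first values from the census -/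

/-- `Λ^v_n(y) − Λ_n(y) = Σ_{ω ∈ ipwb n} (visits − 1) y^{visits}`. [cite: MadrasSlade1993, §4.2, (4.2.2)]
[cite: BeatonBousquetMelouDeGierDuminilCopinGuttmann2014, §3.1 (arXiv v5 p. 8: surface visits)] -/
theorem IPWBV_sub_IPWB_eq_sum (n : ℕ) (y : ℝ) :
    IPWBV n y - IPWB n y = ∑ ω ∈ ipwb n, ((visits n ω : ℝ) - 1) * y ^ visits n ω := by
  rw [IPWBV, IPWB, ← Finset.sum_sub_distrib]
  exact Finset.sum_congr rfl fun ω _ => by ring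

/-- If every block of length `n` visits once, `Λ^v_n = Λ_n`. [cite: MadrasSlade1993, §4.2, (4.2.2)] -/
theorem IPWBV_eq_IPWB_of_visits_eq_one (h : ∀ ω ∈ ipwb n, visits n ω = 1) (y : ℝ) : IPWBV n y = IPWB n y := by
  have hs : ∑ ω ∈ ipwb n, ((visits n ω : ℝ) - 1) * y ^ visits n ω = 0 :=
    Finset.sum_eq_zero fun ω hω => by rw [h ω hω]; simp
  have := IPWBV_sub_IPWB_eq_sum n y
  linarith

/-- The atom class: a block of length two visits once (`4·visits ≤ 4`). [cite: MadrasSlade1993, §4.2, remark before (4.2.21) (p. 94)] -/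
private theorem visits_two_vx {m : ℕ} (hm : m = 2) (hω : ω ∈ ipwb m) : visits m ω = 1 := by
  have h4 := four_mul_visits_le hω
  have h1 := one_le_visits_of_mem_ipwb hω
  subst hm; omega

/-- `Λ^v₂ = Λ₂` (symbolic length). [cite: MadrasSlade1993, §4.2, (4.2.2)] -/
theorem IPWBV_two {m : ℕ} (hm : m = 2) (y : ℝ) : IPWBV m y = IPWB m y :=
  IPWBV_eq_IPWB_of_visits_eq_one (fun _ hω => visits_two_vx hm hω) y

/-- `Λ^v₄ ≡ 0` (`ipwb 4 = ∅`; symbolic length). [cite: MadrasSlade1993, §4.2, (4.2.2)] -/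
theorem IPWBV_four {m : ℕ} (hm : m = 4) (y : ℝ) : IPWBV m y = 0 := by
  rw [IPWBV, ipwb_four_eq_empty hm, Finset.sum_empty]

/-- ★ `Λ^v₆(y) = y` (the dip visits once; symbolic length). [cite: MadrasSlade1993, §4.2, (4.2.2)] [cite: EntingJensen2009, §7.4.2, Fig. 7.10] -/
theorem IPWBV_six {m : ℕ} (hm : m = 6) (y : ℝ) : IPWBV m y = y := by
  rw [IPWBV_eq_IPWB_of_visits_eq_one (fun _ hω => visits_eq_one_of_mem_ipwb_six hm hω), IPWB_six hm]

/-- ★ `Λ^v₈(y) = #(ipwb 8)·y` (one visit at length eight; symbolic length). [cite: MadrasSlade1993, §4.2, (4.2.2)] -/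
theorem IPWBV_eight {m : ℕ} (hm : m = 8) (y : ℝ) : IPWBV m y = #(ipwb m) * y := by
  rw [IPWBV_eq_IPWB_of_visits_eq_one (fun _ hω => visits_eq_one_of_mem_ipwb_eight hm hω), IPWB_eight hm]

/-- ★ `Λ^v₁₀(y) − Λ₁₀(y) ≤ #(ipwb 10)·y²` for every real `y` (one or two visits: the summand is `0` or `y²`; symbolic length). [cite: MadrasSlade1993, §4.2, (4.2.2)] -/
theorem IPWBV_sub_IPWB_ten_le {m : ℕ} (hm : m = 10) (y : ℝ) : IPWBV m y - IPWB m y ≤ #(ipwb m) * y ^ 2 := by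
  rw [IPWBV_sub_IPWB_eq_sum]
  have h := Finset.sum_le_card_nsmul (ipwb m) (fun ω => ((visits m ω : ℝ) - 1) * y ^ visits m ω) (y ^ 2)
    fun ω hω => by
      have h1 := one_le_visits_of_mem_ipwb hω
      have h2 := visits_le_two_of_mem_ipwb_ten hm hω
      rcases (by omega : visits m ω = 1 ∨ visits m ω = 2) with h | h
      · simp only [h]; push_cast; nlinarith [sq_nonneg y]
      · simp only [h]; push_cast; nlinarith [sq_nonneg y]
  rwa [nsmul_eq_mul] at h

/-- **Entropy bound on the visit excess**: `Λ^v_{2s} − Λ_{2s} ≤ ((s − 1)/2) Λ_{2s}` for `y ≥ 0` (`2Λ^v_{2s} ≤ (s+1)Λ_{2s}`).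
[cite: MadrasSlade1993, §4.2, remark before (4.2.21) (p. 94)] -/
theorem IPWBV_sub_IPWB_le_mul (s : ℕ) (hy : 0 ≤ y) :
    IPWBV (2 * s) y - IPWB (2 * s) y ≤ ((s : ℝ) - 1) / 2 * IPWB (2 * s) y := by
  have h := two_mul_IPWBV_le s hy
  linarith

/-! ### §2 `V − 1` as the series of visit excesses, and its census bound -/

/-- **`V(y) − 1 = Σ_s (Λ^v_{2s} − Λ_{2s})(y) β(y)^{−2s}`** for `y > μ⁴` (Kesten's identity `Σ_s f_s = 1`).
[cite: MadrasSlade1993, §4.2, (4.2.4) (p. 91) and Theorem 4.2.2] [cite: Kesten1963SAW, §4] [cite: Giacomin2011, Chapter 2, (2.9)–(2.11)] -/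
theorem hasSum_pwbVisitMean_sub_one (hy : hexConnectiveConstant ^ 4 < y) :
    HasSum (fun s : ℕ => (IPWBV (2 * s) y - IPWB (2 * s) y) / wallRate y ^ (2 * s)) (pwbVisitMean y - 1) := by
  have hV : HasSum (fun s : ℕ => IPWBV (2 * s) y / wallRate y ^ (2 * s)) (pwbVisitMean y) := by
    rw [pwbVisitMean]; exact (summable_IPWBV_div hy).hasSum
  have h := hV.sub (hasSum_pwbLaw hy)
  refine h.congr_fun fun s => ?_
  rw [pwbLaw]
  ring

/-- `0 ≤ V(y) − 1` for `y > μ⁴`. [cite: MadrasSlade1993, §4.2, (4.2.4) (p. 91)] -/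
theorem pwbVisitMean_sub_one_nonneg (hy : hexConnectiveConstant ^ 4 < y) : 0 ≤ pwbVisitMean y - 1 := by
  have := one_le_pwbVisitMean hy
  linarith

/-- The tail of the visit-excess series beyond half-length five sums to `V − 1 − (Λ^v₁₀ − Λ₁₀)/β¹⁰`: the head terms
`s ≤ 4` vanish by the census (symbolic length `m = 10`). [cite: MadrasSlade1993, §4.2, (4.2.4)–(4.2.5) and Theorem 4.2.2] [cite: Feller1968, XIII.3] -/
theorem hasSum_visitExcess_nat_add (hy : hexConnectiveConstant ^ 4 < y) {m : ℕ} (hm : m = 10) :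
    HasSum (fun j : ℕ => (IPWBV (2 * (j + 6)) y - IPWB (2 * (j + 6)) y) / wallRate y ^ (2 * (j + 6)))
      (pwbVisitMean y - 1 - (IPWBV m y - IPWB m y) / wallRate y ^ 10) := by
  have h := (hasSum_nat_add_iff' 6).2 (hasSum_pwbVisitMean_sub_one hy)
  have e0 : IPWBV (2 * 0) y - IPWB (2 * 0) y = 0 := by rw [Nat.mul_zero, IPWBV_zero, IPWB_zero, sub_self]
  have e1 : IPWBV (2 * 1) y - IPWB (2 * 1) y = 0 := by rw [IPWBV_two (m := 2 * 1) (by norm_num), sub_self]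
  have e2 : IPWBV (2 * 2) y - IPWB (2 * 2) y = 0 := by
    rw [IPWBV_four (m := 2 * 2) (by norm_num), IPWB_four (m := 2 * 2) (by norm_num), sub_self]
  have e3 : IPWBV (2 * 3) y - IPWB (2 * 3) y = 0 := by
    rw [IPWBV_six (m := 2 * 3) (by norm_num), IPWB_six (m := 2 * 3) (by norm_num), sub_self]
  have e4 : IPWBV (2 * 4) y - IPWB (2 * 4) y = 0 := by
    rw [IPWBV_eight (m := 2 * 4) (by norm_num), IPWB_eight (m := 2 * 4) (by norm_num), sub_self]
  have e5 : (IPWBV (2 * 5) y - IPWB (2 * 5) y) / wallRate y ^ (2 * 5) = (IPWBV m y - IPWB m y) / wallRate y ^ 10 := by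
    rw [hm]
  have hsum : ∑ i ∈ Finset.range 6, (IPWBV (2 * i) y - IPWB (2 * i) y) / wallRate y ^ (2 * i)
      = (IPWBV m y - IPWB m y) / wallRate y ^ 10 := by
    rw [Finset.sum_range_succ, Finset.sum_range_succ, Finset.sum_range_succ, Finset.sum_range_succ,
      Finset.sum_range_succ, Finset.sum_range_succ, Finset.sum_range_zero, e0, e1, e2, e3, e4, e5]
    simp
  rw [hsum] at h
  exact h

/-- ★★ **Census bound on the visit excess** (`y ≥ 48`; symbolic length `m = 10`):
`V(y) − 1 ≤ #(ipwb 10)·y²/β¹⁰ + 6μ¹⁴/(y²√y)` — the `s = 5` term plus half of «EXCESS-LIMIT»'s tail.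
[cite: MadrasSlade1993, §4.2, (4.2.4)–(4.2.5), Theorem 4.2.2 and remark before (4.2.21)] [cite: Kesten1963SAW, §4] -/
theorem pwbVisitMean_sub_one_le_census {m : ℕ} (hm : m = 10) (hy : 48 ≤ y) :
    pwbVisitMean y - 1 ≤ #(ipwb m) * y ^ 2 / wallRate y ^ 10 + 6 * hexConnectiveConstant ^ 14 / (y ^ 2 * Real.sqrt y) := by
  have hy0 : 0 < y := by linarith
  have hμ := mu_four_lt_of_ge_vx hy
  have ht := hasSum_visitExcess_nat_add hμ hm
  have hT := hasSum_excess_tail hμ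
  have hTle := excess_tail_le hy
  have hle : ∀ j : ℕ, (IPWBV (2 * (j + 6)) y - IPWB (2 * (j + 6)) y) / wallRate y ^ (2 * (j + 6)) ≤
      1 / 2 * (((j : ℝ) + 5) * pwbLaw y (j + 6)) := by
    intro j
    have h := IPWBV_sub_IPWB_le_mul (j + 6) hy0.le
    have hβ : 0 < wallRate y ^ (2 * (j + 6)) := pow_pos (wallRate_pos y) _
    rw [pwbLaw]
    calc (IPWBV (2 * (j + 6)) y - IPWB (2 * (j + 6)) y) / wallRate y ^ (2 * (j + 6))
        ≤ (((j + 6 : ℕ) : ℝ) - 1) / 2 * IPWB (2 * (j + 6)) y / wallRate y ^ (2 * (j + 6)) :=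
          div_le_div_of_nonneg_right h hβ.le
      _ = 1 / 2 * (((j : ℝ) + 5) * (IPWB (2 * (j + 6)) y / wallRate y ^ (2 * (j + 6)))) := by
          push_cast; ring
  have hsum := hasSum_le hle ht (hT.mul_left (1 / 2))
  have h10 : (IPWBV m y - IPWB m y) / wallRate y ^ 10 ≤ #(ipwb m) * y ^ 2 / wallRate y ^ 10 :=
    div_le_div_of_nonneg_right (IPWBV_sub_IPWB_ten_le hm y) (pow_nonneg (wallRate_pos y).le _)
  have hhalf : 1 / 2 * (pwbMean y - 1 - (2 * pwbLaw y 3 + 3 * pwbLaw y 4 + 4 * pwbLaw y 5)) ≤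
      6 * hexConnectiveConstant ^ 14 / (y ^ 2 * Real.sqrt y) := by
    have e : 6 * hexConnectiveConstant ^ 14 / (y ^ 2 * Real.sqrt y) =
        1 / 2 * (12 * hexConnectiveConstant ^ 14 / (y ^ 2 * Real.sqrt y)) := by ring
    rw [e]
    exact mul_le_mul_of_nonneg_left hTle (by norm_num)
  linarith

/-- ★★ **Explicit bound**: `V(y) − 1 ≤ 59049/y³ + 6μ¹⁴/(y²√y)` for `y ≥ 48` (`#(ipwb 10) ≤ 3¹⁰`, `β² ≥ y`).
[cite: MadrasSlade1993, §1.2, (1.2.3) and §4.2, Theorem 4.2.2] [cite: JansevanRensburgWhittington2013, §3.1 (strong-adsorption expansions)] -/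
theorem pwbVisitMean_sub_one_le (hy : 48 ≤ y) :
    pwbVisitMean y - 1 ≤ 59049 / y ^ 3 + 6 * hexConnectiveConstant ^ 14 / (y ^ 2 * Real.sqrt y) := by
  obtain ⟨m, hm⟩ : ∃ m : ℕ, m = 10 := ⟨_, rfl⟩
  have h := pwbVisitMean_sub_one_le_census hm hy
  have hy0 : 0 < y := by linarith
  have hB : y ≤ wallRate y ^ 2 := le_sq_wallRate_vx hy0
  have h10 : y ^ 5 ≤ wallRate y ^ 10 := by
    rw [show (10 : ℕ) = 2 * 5 by norm_num, pow_mul]; exact pow_le_pow_left₀ hy0.le hB 5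
  have e3 : (3 : ℝ) ^ m = 59049 := by rw [hm]; norm_num
  have hc : (#(ipwb m) : ℝ) ≤ 59049 := e3 ▸ card_ipwb_le_three_pow m
  have h1 : #(ipwb m) * y ^ 2 / wallRate y ^ 10 ≤ 59049 * y ^ 2 / y ^ 5 :=
    calc #(ipwb m) * y ^ 2 / wallRate y ^ 10 ≤ #(ipwb m) * y ^ 2 / y ^ 5 :=
          div_le_div_of_nonneg_left (by positivity) (by positivity) h10
      _ ≤ 59049 * y ^ 2 / y ^ 5 := by gcongr
  have e2 : (59049 : ℝ) * y ^ 2 / y ^ 5 = 59049 / y ^ 3 := by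
    rw [div_eq_div_iff (by positivity) (by positivity)]; ring
  linarith

/-- ★ Scaled form: `y²(V(y) − 1) ≤ 59049/y + 6μ¹⁴/√y` for `y ≥ 48`. [cite: MadrasSlade1993, §4.2, Theorem 4.2.2] -/
theorem sq_mul_pwbVisitMean_sub_one_le (hy : 48 ≤ y) :
    y ^ 2 * (pwbVisitMean y - 1) ≤ 59049 / y + 6 * hexConnectiveConstant ^ 14 / Real.sqrt y := by
  have hy0 : 0 < y := by linarith
  have hs : 0 < Real.sqrt y := Real.sqrt_pos.2 hy0
  have h := mul_le_mul_of_nonneg_left (pwbVisitMean_sub_one_le hy) (sq_nonneg y)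
  have e1 : y ^ 2 * (59049 / y ^ 3) = 59049 / y := by
    rw [mul_div_assoc', div_eq_div_iff (by positivity) (by positivity)]; ring
  have e2 : y ^ 2 * (6 * hexConnectiveConstant ^ 14 / (y ^ 2 * Real.sqrt y)) = 6 * hexConnectiveConstant ^ 14 / Real.sqrt y := by
    rw [mul_div_assoc', div_eq_div_iff (by positivity) (by positivity)]; ring
  rw [mul_add, e1, e2] at h
  exact h

/-- ★★★ **TO SECOND ORDER EVERY RENEWAL BLOCK VISITS THE SURFACE ONCE: `y²(V(y) − 1) → 0`** as `y → ∞`. NEW.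
[cite: MadrasSlade1993, §4.2, Theorem 4.2.2 (pp. 91–92)] [cite: Kesten1963SAW, §4] [cite: JansevanRensburgWhittington2013, §3.1] -/
theorem tendsto_sq_mul_pwbVisitMean_sub_one : Tendsto (fun y : ℝ => y ^ 2 * (pwbVisitMean y - 1)) atTop (𝓝 0) := by
  have h1 : Tendsto (fun y : ℝ => (59049 : ℝ) / y) atTop (𝓝 0) := tendsto_const_nhds.div_atTop tendsto_id
  have h2 : Tendsto (fun y : ℝ => 6 * hexConnectiveConstant ^ 14 / Real.sqrt y) atTop (𝓝 0) :=
    tendsto_const_nhds.div_atTop Real.tendsto_sqrt_atTop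
  have hup : Tendsto (fun y : ℝ => 59049 / y + 6 * hexConnectiveConstant ^ 14 / Real.sqrt y) atTop (𝓝 0) := by
    simpa using h1.add h2
  refine tendsto_of_tendsto_of_tendsto_of_le_of_le' tendsto_const_nhds hup ?_ ?_
  · filter_upwards [eventually_gt_atTop (hexConnectiveConstant ^ 4)] with y hy
    exact mul_nonneg (sq_nonneg y) (pwbVisitMean_sub_one_nonneg hy)
  · filter_upwards [eventually_ge_atTop (48 : ℝ)] with y hy using sq_mul_pwbVisitMean_sub_one_le hy

/-- ★ **`V(y) − 1 = O(1/(y²√y))`** as `y → ∞`. [cite: MadrasSlade1993, §4.2, Theorem 4.2.2 (pp. 91–92)] [cite: JansevanRensburgWhittington2013, §3.1] -/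
theorem isBigO_pwbVisitMean_sub_one :
    (fun y : ℝ => pwbVisitMean y - 1) =O[atTop] fun y : ℝ => 1 / (y ^ 2 * Real.sqrt y) := by
  refine IsBigO.of_bound (59049 + 6 * hexConnectiveConstant ^ 14) ?_
  filter_upwards [eventually_ge_atTop (48 : ℝ)] with y hy
  have hy0 : 0 < y := by linarith
  have hy1 : 1 ≤ y := by linarith
  have hs : 0 < Real.sqrt y := Real.sqrt_pos.2 hy0
  have hs1 : 1 ≤ Real.sqrt y := Real.one_le_sqrt.2 hy1
  rw [Real.norm_of_nonneg (pwbVisitMean_sub_one_nonneg (mu_four_lt_of_ge_vx hy)), Real.norm_of_nonneg (by positivity)]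
  have h := pwbVisitMean_sub_one_le hy
  have hss : Real.sqrt y * Real.sqrt y = y := Real.mul_self_sqrt hy0.le
  have hsqy : Real.sqrt y ≤ y :=
    calc Real.sqrt y = Real.sqrt y * 1 := (mul_one _).symm
      _ ≤ Real.sqrt y * Real.sqrt y := mul_le_mul_of_nonneg_left hs1 hs.le
      _ = y := hss
  have hsy : y ^ 2 * Real.sqrt y ≤ y ^ 3 :=
    calc y ^ 2 * Real.sqrt y ≤ y ^ 2 * y := mul_le_mul_of_nonneg_left hsqy (sq_nonneg y)
      _ = y ^ 3 := by ring
  have h3 : (59049 : ℝ) / y ^ 3 ≤ 59049 / (y ^ 2 * Real.sqrt y) :=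
    div_le_div_of_nonneg_left (by norm_num) (by positivity) hsy
  have e : (59049 + 6 * hexConnectiveConstant ^ 14) * (1 / (y ^ 2 * Real.sqrt y)) =
      59049 / (y ^ 2 * Real.sqrt y) + 6 * hexConnectiveConstant ^ 14 / (y ^ 2 * Real.sqrt y) := by ring
  rw [e]
  linarith

/-! ### §3 The cross-check: `y²(m − V) → 2` from the density coefficient and the renewal–reward identity -/

/-- **`m(y) − V(y) = 2m(y)·(1/2 − ρ⁺(log y))`** for `y > μ⁴` (the renewal–reward identity `ρ⁺ = V/(2m)` of «NO-KINK»).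
[cite: Giacomin2011, Chapter 2, (2.11)] [cite: BeatonBousquetMelouDeGierDuminilCopinGuttmann2014, §3.1, Proposition 5 (arXiv v5 p. 9)] -/
theorem pwbMean_sub_pwbVisitMean_eq (hy : hexConnectiveConstant ^ 4 < y) :
    pwbMean y - pwbVisitMean y = 2 * pwbMean y * (1 / 2 - wallRightDensity (Real.log y)) := by
  have hy0 : 0 < y := by have := four_le_mu_four_vx; linarith
  have ht : hexConnectiveConstant ^ 4 < Real.exp (Real.log y) := by rwa [Real.exp_log hy0]
  have h := wallRightDensity_eq_visitMean_div ht
  rw [Real.exp_log hy0] at h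
  have hm := pwbMean_pos hy
  have e : 2 * pwbMean y * (pwbVisitMean y / (2 * pwbMean y)) = pwbVisitMean y := by
    rw [mul_div_assoc', mul_div_cancel_left₀ _ (mul_pos two_pos hm).ne']
  rw [h, mul_sub, e]
  ring

/-- ★★ **`y²(m(y) − V(y)) → 2`** as `y → ∞` — from the TREE's density coefficient `e^{2t}(1/2 − ρ⁺(t)) → 1`, the identity
`ρ⁺ = V/(2m)` and `m → 1`; no census involved.  With «EXCESS-LIMIT»'s `y²(m − 1) → 2` and `y²(V − 1) → 0` above: `2 = 2 − 0`.
[cite: BeatonBousquetMelouDeGierDuminilCopinGuttmann2014, §3.1, Proposition 5 (arXiv v5 p. 9); p. 10 (first-order remark)]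
[cite: Giacomin2011, Chapter 2, (2.11)] [cite: JansevanRensburg2000, §3.3] -/
theorem tendsto_sq_mul_pwbMean_sub_pwbVisitMean :
    Tendsto (fun y : ℝ => y ^ 2 * (pwbMean y - pwbVisitMean y)) atTop (𝓝 2) := by
  have h1 : Tendsto (fun y : ℝ => Real.exp (2 * Real.log y) * (1 / 2 - wallRightDensity (Real.log y))) atTop (𝓝 1) :=
    tendsto_exp_mul_half_sub_wallRightDensity.comp Real.tendsto_log_atTop
  have h2 : Tendsto (fun y : ℝ => 2 * pwbMean y) atTop (𝓝 2) := by
    simpa using tendsto_pwbMean_vx.const_mul 2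
  have h := h2.mul h1
  rw [mul_one] at h
  refine h.congr' ?_
  filter_upwards [eventually_gt_atTop (hexConnectiveConstant ^ 4)] with y hy
  have hy0 : 0 < y := by have := four_le_mu_four_vx; linarith
  rw [pwbMean_sub_pwbVisitMean_eq hy, show (2 : ℝ) * Real.log y = Real.log y + Real.log y by ring, Real.exp_add,
    Real.exp_log hy0]
  ring

/-- ★ The same for the left density: `m − V = 2m(1/2 − ρ⁻(log y))` (no kink on the regime). [cite: Giacomin2011, Chapter 2, (2.11)]
[cite: JansevanRensburgWhittington2013, §3.1 eq. (3.4) (arXiv v4 p. 6)] -/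
theorem pwbMean_sub_pwbVisitMean_eq_left (hy : hexConnectiveConstant ^ 4 < y) :
    pwbMean y - pwbVisitMean y = 2 * pwbMean y * (1 / 2 - wallLeftDensity (Real.log y)) := by
  have hy0 : 0 < y := by have := four_le_mu_four_vx; linarith
  have ht : hexConnectiveConstant ^ 4 < Real.exp (Real.log y) := by rwa [Real.exp_log hy0]
  rw [wallLeftDensity_eq_wallRightDensity ht]
  exact pwbMean_sub_pwbVisitMean_eq hy

/-- ★ **`V(y) → 1`** as `y → ∞`. [cite: MadrasSlade1993, §4.2, Theorem 4.2.2 (pp. 91–92)] -/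
theorem tendsto_pwbVisitMean : Tendsto pwbVisitMean atTop (𝓝 1) := by
  have h0 : Tendsto (fun y : ℝ => y ^ 2 * (pwbVisitMean y - 1) / y ^ 2) atTop (𝓝 0) :=
    tendsto_sq_mul_pwbVisitMean_sub_one.div_atTop (tendsto_pow_atTop two_ne_zero)
  have h1 : Tendsto (fun y : ℝ => y ^ 2 * (pwbVisitMean y - 1) / y ^ 2 + 1) atTop (𝓝 1) := by
    simpa using h0.add_const 1
  refine h1.congr' ?_
  filter_upwards [eventually_gt_atTop (0 : ℝ)] with y hy
  have hy2 : y ^ 2 ≠ 0 := by positivity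
  rw [mul_div_cancel_left₀ _ hy2]
  ring

end Literature.Probability.RandomPlanarGeometry.SAW.HexBW.Wall
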